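import Literature.NumberTheory.EllipticCurves.FineSelmerLayerCriterionRatEigen
import HarnessLib

/-!
# Door L5 on the CANONICAL torsion-point field `ℚ_{n+1}(P)` of the layer: Conjecture A for `E/ℚ` from the
# `S`-split tautological eigenspace of `Cl(ℚ_{n+1}(P))` (proofs only: no definition, no named fact)

`Proofs` file in topic `NumberTheory/EllipticCurves` (seat `bsd-potss-conjA-anchor` g18, follow-up (ii b)).  The door
`CoatesSujatha2005.conjA_of_eigenHom_subfield_layer` (file `FineSelmerLayerCriterionRatEigen`) takes an arbitrary
subfield `K ⊆ L = ℚ(E[p])ℚ_{n+1}` with `Γ_K` fixing `P` and `p ∤ [L : K]`, leaving those two verifications to the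
consumer.  Here `K` is FIXED to the canonical choice

  `K = ℚ_{n+1}(P) := Fix_L( (Stab_{Γ_ℚ}(P) ∩ Gal(ℚ̄/ℚ_{n+1}))|_L )`,

the subfield of `L` cut out by the elements of `Γ_ℚ` that fix `P` AND the layer `ℚ_{n+1}`, and the two side
conditions are PROVED:

* `Γ_K` fixes `P`: an element whose restriction to `L` fixes `K` restricts like some `τ₀ ∈ Stab(P) ∩ Λ_{n+1}`
  (finite Galois correspondence `Fix(Fix H) = H`), and elements with trivial restriction to `L ⊇ ℚ(E[p])` act
  trivially on `E[p]`;
* `p ∤ [L : K] = #((Stab(P) ∩ Λ_{n+1})|_L)`: on `Stab(P) ∩ Λ_{n+1}` the kernels of the restrictions to `L` and to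
  `L₀ = ℚ(E[p])` AGREE (an element fixing `ℚ_{n+1}` and `ℚ(E[p])` fixes their compositum `L`), so
  `(Stab(P) ∩ Λ_{n+1})|_L ≅ (Stab(P) ∩ Λ_{n+1})|_{L₀} ≤ Gal(ℚ(E[p])/ℚ)`, of order prime to `p` by (c1).

Result `CoatesSujatha2005.conjA_of_eigenHom_stabilizerField_layer`: **(A) for `E/ℚ` at `p` odd from `E[p]`
irreducible, (c1), `κ` cyclotomic, the local data (c3′)/(c3*) at the bad places, a point `P ≠ 0` of `E[p]`, and
the `S`-split tautological-eigenspace condition on `Cl(𝓞_{ℚ_{n+1}(P)}) ⊗ 𝔽_p`** — the only global datum, on a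
field of degree `[ℚ(P):ℚ] · p^{n+1}` (`24` at `p = 3`, `n = 0` for the cell's rows), stated for the `K` above
(`∀ K [NumberField K], K = Fix(…) → …`, so that a record instantiates it with its own description of `ℚ_{n+1}(P)`).

HONEST FRAMING: theorems only, no new facts; nothing about BSD is claimed.

## References

* [CoatesSujatha2005] J. Coates, R. Sujatha, Math. Ann. 331 (2005), §3 Thm. 3.4, Lemma 3.8.
* [DeoRaySujatha2023] S. V. Deo, A. Ray, R. Sujatha, PAMQ 19 (2023), §3 Thm. 3.8 (c2), `H′_L` (arXiv p. 9).
* [NeukirchANT1999] J. Neukirch, *Algebraic Number Theory* (1999), Ch. IV §1 (infinite Galois theory, (1.1)),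
  Ch. III §1 (1.6)(iv).
* [Washington1997] L. C. Washington, *Introduction to Cyclotomic Fields*, §13.1.
-/

set_option autoImplicit false

noncomputable section

open scoped Classical Pointwise nonZeroDivisors
open NumberField Field IntermediateField IsDedekindDomain WeierstrassCurve
open Literature.NumberTheory.GaloisRepresentations Literature.NumberTheory.NumberFields
open Literature.NumberTheory.EllipticCurves Literature.NumberTheory.EllipticCurves.GreenbergSelmer

namespace Literature.NumberTheory.EllipticCurves.CoatesSujatha2005

variable {p : ℕ} [Fact p.Prime]

/-- **On a subgroup fixing `E₂`, the restrictions to `E₁ ⊔ E₂` and to `E₁` have the same kernel.**  For normal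
subextensions `E₁`, `E₁ ⊔ E₂` of `F̄/F` and `g ∈ Γ_F` fixing `E₂` pointwise (`toAlgEquiv g ∈ E₂.fixingSubgroup`):
`g|_{E₁ ⊔ E₂} = 1 ↔ g|_{E₁} = 1` (Galois correspondence: `Fix(E₁ ⊔ E₂) = Fix(E₁) ∩ Fix(E₂)`).
[cite: NeukirchANT1999, Ch. IV §1 Thm. (1.1)] -/
theorem absRestrictNormalHom_sup_eq_one_iff_of_mem_fixingSubgroup {F : Type} [Field F]
    (E₁ E₂ : IntermediateField F (AlgebraicClosure F)) [Normal F E₁] [Normal F ↥(E₁ ⊔ E₂)]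
    {g : absoluteGaloisGroup F} (hg : absoluteGaloisGroup.toAlgEquiv F g ∈ E₂.fixingSubgroup) :
    absRestrictNormalHom (E₁ ⊔ E₂) g = 1 ↔ absRestrictNormalHom E₁ g = 1 := by
  rw [absRestrictNormalHom_eq_one_iff, absRestrictNormalHom_eq_one_iff, IntermediateField.fixingSubgroup_sup,
    Subgroup.mem_inf]
  exact ⟨fun h => h.1, fun h => ⟨h, hg⟩⟩

/-- **`#((S)|_{E₁ ⊔ E₂})` divides `#Gal(E₁/F)` for a subgroup `S ≤ Γ_F` fixing `E₂` pointwise** (`E₁`, `E₁ ⊔ E₂`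
finite normal): on `S` the restrictions to `E₁ ⊔ E₂` and to `E₁` have the same kernel
(`absRestrictNormalHom_sup_eq_one_iff_of_mem_fixingSubgroup`), so `S|_{E₁ ⊔ E₂} ≅ S/(S ∩ ker) ≅ S|_{E₁} ≤ Gal(E₁/F)`
(first isomorphism theorem, Lagrange). [cite: NeukirchANT1999, Ch. IV §1 Thm. (1.1)] -/
theorem card_map_absRestrictNormalHom_sup_dvd {F : Type} [Field F]
    (E₁ E₂ : IntermediateField F (AlgebraicClosure F)) [Normal F E₁] [Normal F ↥(E₁ ⊔ E₂)]
    (S : Subgroup (absoluteGaloisGroup F))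
    (hS : ∀ g ∈ S, absoluteGaloisGroup.toAlgEquiv F g ∈ E₂.fixingSubgroup) :
    Nat.card (S.map (absRestrictNormalHom (E₁ ⊔ E₂))) ∣ Nat.card (E₁ ≃ₐ[F] E₁) := by
  have hker : ((absRestrictNormalHom (E₁ ⊔ E₂)).restrict S).ker =
      ((absRestrictNormalHom E₁).restrict S).ker := by
    rw [MonoidHom.ker_restrict, MonoidHom.ker_restrict]
    ext g
    rw [Subgroup.mem_subgroupOf, Subgroup.mem_subgroupOf, MonoidHom.mem_ker, MonoidHom.mem_ker]
    exact absRestrictNormalHom_sup_eq_one_iff_of_mem_fixingSubgroup E₁ E₂ (hS g g.2)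
  have h1 : Nat.card (S.map (absRestrictNormalHom (E₁ ⊔ E₂))) =
      Nat.card ((absRestrictNormalHom (E₁ ⊔ E₂)).restrict S).range := by
    rw [MonoidHom.restrict_range]
  have h2 : Nat.card ((absRestrictNormalHom (E₁ ⊔ E₂)).restrict S).range =
      Nat.card (S ⧸ ((absRestrictNormalHom (E₁ ⊔ E₂)).restrict S).ker) :=
    Nat.card_congr (QuotientGroup.quotientKerEquivRange _).symm.toEquiv
  have h3 : Nat.card (S ⧸ ((absRestrictNormalHom (E₁ ⊔ E₂)).restrict S).ker) =
      Nat.card (S ⧸ ((absRestrictNormalHom E₁).restrict S).ker) :=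
    Nat.card_congr (QuotientGroup.quotientMulEquivOfEq hker).toEquiv
  have h4 : Nat.card (S ⧸ ((absRestrictNormalHom E₁).restrict S).ker) =
      Nat.card ((absRestrictNormalHom E₁).restrict S).range :=
    Nat.card_congr (QuotientGroup.quotientKerEquivRange _).toEquiv
  rw [h1, h2, h3, h4]
  exact Subgroup.card_subgroup_dvd_card _

/-- **The fixed field of `S|_L`, `S ≤ Stab(P)`, has absolute Galois group fixing `P`** — for finite normal
`L₀ ≤ L` inside `F̄` and a `Γ_F`-set on which the elements with trivial restriction to `L₀` act trivially: if
`τ|_L` fixes `Fix_L(S|_L)` pointwise then `τ|_L ∈ S|_L` (`Fix(Fix H) = H`), `τ = τ₀ · (τ₀⁻¹τ)` with `τ₀ ∈ S` and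
`(τ₀⁻¹τ)|_{L₀} = 1`, so `τ • P = τ₀ • P = P`. [cite: NeukirchANT1999, Ch. IV §1 Thm. (1.1)] -/
theorem smul_eq_of_forall_fixedField_map_absRestrictNormalHom {F : Type} [Field F]
    (L₀ L : IntermediateField F (AlgebraicClosure F)) [Normal F L₀] [Normal F L] [FiniteDimensional F L]
    (hL₀ : L₀ ≤ L) {V : Type*} [MulAction (absoluteGaloisGroup F) V] {P : V}
    (hV : ∀ τ : absoluteGaloisGroup F, absRestrictNormalHom L₀ τ = 1 → τ • P = P)
    (S : Subgroup (absoluteGaloisGroup F)) (hS : S ≤ MulAction.stabilizer (absoluteGaloisGroup F) P)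
    (τ : absoluteGaloisGroup F)
    (hτ : ∀ x : IntermediateField.fixedField (S.map (absRestrictNormalHom L)),
      absRestrictNormalHom L τ (x : L) = x) :
    τ • P = P := by
  have h1 : absRestrictNormalHom L τ ∈
      (IntermediateField.fixedField (S.map (absRestrictNormalHom L))).fixingSubgroup := by
    rw [IntermediateField.mem_fixingSubgroup_iff]
    intro x hx
    exact hτ ⟨x, hx⟩
  rw [IntermediateField.fixingSubgroup_fixedField] at h1
  obtain ⟨τ₀, hτ₀, hres⟩ := Subgroup.mem_map.mp h1
  have h2 : absRestrictNormalHom L (τ₀⁻¹ * τ) = 1 := by rw [map_mul, map_inv, hres, inv_mul_cancel]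
  have h3 : absRestrictNormalHom L₀ (τ₀⁻¹ * τ) = 1 := ker_absRestrictNormalHom_le L₀ hL₀ h2
  have h4 := hV _ h3
  rw [mul_smul, inv_smul_eq_iff] at h4
  rw [h4]
  exact hS hτ₀

set_option synthInstance.maxHeartbeats 200000 in
set_option maxHeartbeats 800000 in
/-- **Conjecture A for `E/ℚ` from the `S`-split tautological eigenspace of `Cl(ℚ_{n+1}(P))`, canonical `K`.**
`E/ℚ` elliptic (`W`), `p` odd, `E[p]` irreducible, (c1) `p ∤ #Gal(ℚ(E[p])/ℚ)`, `κ` the cyclotomic `ℤ_p`-extension,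
`n : ℕ`, `bad` a set of finite places carrying (c3′) `¬ (D_u ≤ κ.layerSubgroup (n+1))` or (c3*) `E[p]^{D_u} = 0`,
`P ∈ E[p] ∖ 0`, and — for THE subfield `K = Fix_L((Stab(P) ⊓ κ.layerSubgroup (n+1))|_L)` of
`L = ℚ(E[p])ℚ_{n+1}` (`= ℚ_{n+1}(P)`) — every additive `μ : Cl(𝓞_K) → ℤ/p` that is a tautological
eigenfunctional (`μ([σ̄ I]) = a • μ([I])` for `σ̄ = τ|_K`, `τ • P = a • P`) and kills the class of every prime of
`K` above `p` or above a bad place vanishes.  Then statement (A) holds for `E` at `p`.  Proof: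
`conjA_of_eigenHom_subfield_layer` with this `K`; `Γ_K` fixes `P`
(`smul_eq_of_forall_fixedField_map_absRestrictNormalHom`) and `p ∤ [L : K] = #((Stab(P) ⊓ Λ_{n+1})|_L)`
(`finrank_fixedField_eq_card`, `card_map_absRestrictNormalHom_sup_dvd` with `E₂ = ℚ_{n+1}` fixed by `Λ_{n+1}`,
and (c1)). [cite: CoatesSujatha2005, §3 Thm. 3.4 and Lemma 3.8]
[cite: DeoRaySujatha2023, §3 Thm. 3.8 (c2) and the definition of H′_L (arXiv:2202.09937 p. 9)]
[cite: NeukirchANT1999, Ch. IV §1 Thm. (1.1); Ch. III §1 Prop. (1.6) (iv)] [cite: Washington1997, §13.1] -/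
theorem conjA_of_eigenHom_stabilizerField_layer
    (W : WeierstrassCurve ℚ) [W.IsElliptic] (hp2 : p ≠ 2)
    (hirr : W.HasIrreducibleModPGaloisRep p)
    (hG : ¬ p ∣ Nat.card ((W.divisionField p) ≃ₐ[ℚ] (W.divisionField p)))
    {κ : ZpExtension ℚ p} (hκ : κ.IsCyclotomic) (n : ℕ)
    (bad : HeightOneSpectrum (𝓞 ℚ) → Prop)
    (hbad : ∀ u : HeightOneSpectrum (𝓞 ℚ), bad u →
      ¬ (GreenbergSelmer.decomp u ≤ κ.layerSubgroup (n + 1)) ∨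
      (∀ x : geomTorsion W (p : ℤ), (∀ d ∈ GreenbergSelmer.decomp u, d • x = x) → x = 0))
    (P : geomTorsion W (p : ℤ)) (hP0 : P ≠ 0)
    (hEig : haveI := κ.isGalois_layer_holds (n + 1)
      ∀ (K : IntermediateField ℚ ↥(W.divisionField p ⊔ κ.layer (n + 1))) [NumberField K],
        K = IntermediateField.fixedField (Subgroup.map
          (N := (↥(W.divisionField p ⊔ κ.layer (n + 1)) ≃ₐ[ℚ] ↥(W.divisionField p ⊔ κ.layer (n + 1))))
          (absRestrictNormalHom (W.divisionField p ⊔ κ.layer (n + 1)))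
          (MulAction.stabilizer (absoluteGaloisGroup ℚ) P ⊓ κ.layerSubgroup (n + 1))) →
      ∀ μ : Additive (ClassGroup (𝓞 K)) →+ ZMod p,
      (∀ (τ : absoluteGaloisGroup ℚ) (σ : K ≃ₐ[ℚ] K) (a : ℕ),
          (∀ x : K, absRestrictNormalHom (W.divisionField p ⊔ κ.layer (n + 1)) τ
              (x : ↥(W.divisionField p ⊔ κ.layer (n + 1))) =
            ((σ x : K) : ↥(W.divisionField p ⊔ κ.layer (n + 1)))) → τ • P = a • P →
          ∀ (I J : (Ideal (𝓞 K))⁰),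
            (J : Ideal (𝓞 K)) = (I : Ideal (𝓞 K)).map (AmbiguousClass.intAut σ : 𝓞 K →+* 𝓞 K) →
            μ (Additive.ofMul (ClassGroup.mk0 J)) = a • μ (Additive.ofMul (ClassGroup.mk0 I))) →
      (∀ (𝔮 : HeightOneSpectrum (𝓞 K)) (q : ℕ) (v : HeightOneSpectrum (𝓞 ℚ)), q.Prime →
          ((q : ℕ) : 𝓞 K) ∈ 𝔮.asIdeal → ((q : ℕ) : 𝓞 ℚ) ∈ v.asIdeal →
          (((p : ℕ) : 𝓞 ℚ) ∈ v.asIdeal ∨ bad v) →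
          μ (Additive.ofMul (ClassGroup.mk0
            ⟨𝔮.asIdeal, mem_nonZeroDivisors_of_ne_zero 𝔮.ne_bot⟩)) = 0) →
      μ = 0) :
    ∃ (γ : absoluteGaloisGroup ℚ) (D : W.FineSelmerDualData κ γ),
      Module.Finite ℤ_[p] (RestrictScalars ℤ_[p] (IwasawaAlgebra p) D.X) := by
  have hpp : p.Prime := Fact.out
  haveI : NeZero p := ⟨hpp.ne_zero⟩
  haveI := κ.isGalois_layer_holds (n + 1)
  haveI := κ.finiteDimensional_layer_holds (n + 1)
  haveI hNF : NumberField ↥(W.divisionField p ⊔ κ.layer (n + 1)) := NumberField.of_module_finite ℚ _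
  have hL₀ : W.divisionField p ≤ W.divisionField p ⊔ κ.layer (n + 1) := le_sup_left
  -- (b) `Γ_K` fixes `P`
  have hPK := smul_eq_of_forall_fixedField_map_absRestrictNormalHom (W.divisionField p)
    (W.divisionField p ⊔ κ.layer (n + 1)) hL₀ (P := P)
    (fun τ hτ => (W.absRestrictNormalHom_divisionField_eq_one_iff p τ).mp hτ P)
    (MulAction.stabilizer (absoluteGaloisGroup ℚ) P ⊓ κ.layerSubgroup (n + 1)) inf_le_left
  -- (c) `p ∤ [L : K] = #((Stab(P) ⊓ Λ_{n+1})|_L)`, which divides `#Gal(ℚ(E[p])/ℚ)`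
  have hfix : ∀ g ∈ MulAction.stabilizer (absoluteGaloisGroup ℚ) P ⊓ κ.layerSubgroup (n + 1),
      absoluteGaloisGroup.toAlgEquiv ℚ g ∈ (κ.layer (n + 1)).fixingSubgroup := by
    intro g hg
    rw [κ.fixingSubgroup_layer (n + 1)]
    exact Subgroup.mem_map_of_mem _ (Subgroup.mem_inf.mp hg).2
  have hdvd := card_map_absRestrictNormalHom_sup_dvd (W.divisionField p) (κ.layer (n + 1))
    (MulAction.stabilizer (absoluteGaloisGroup ℚ) P ⊓ κ.layerSubgroup (n + 1)) hfix
  have hLK : ¬ p ∣ Module.finrank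
      ↥(IntermediateField.fixedField (Subgroup.map
          (N := (↥(W.divisionField p ⊔ κ.layer (n + 1)) ≃ₐ[ℚ] ↥(W.divisionField p ⊔ κ.layer (n + 1))))
          (absRestrictNormalHom (W.divisionField p ⊔ κ.layer (n + 1)))
          (MulAction.stabilizer (absoluteGaloisGroup ℚ) P ⊓ κ.layerSubgroup (n + 1))))
      ↥(W.divisionField p ⊔ κ.layer (n + 1)) := by
    rw [IntermediateField.finrank_fixedField_eq_card]
    exact fun h => hG (h.trans hdvd)
  exact conjA_of_eigenHom_subfield_layer W hp2 hirr hG hκ n bad hbad _ P hP0 hPK hLK (hEig _ rfl)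

end Literature.NumberTheory.EllipticCurves.CoatesSujatha2005

end
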